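import Literature.MathematicalPhysics.QuantumLattice.HubbardEffectiveActionCT
import Literature.MathematicalPhysics.QuantumLattice.GrassmannRelabelling
import Literature.MathematicalPhysics.QuantumLattice.SymmetricRegimeFunctionals
import HarnessLib

/-!
# Spin exchange `ψ̂^c_{k,↑} ↔ ψ̂^c_{k,↓}` is a symmetry of the countertermed Hubbard effective action
# (no pair seed); the self-energy is spin independent

Topic `MathematicalPhysics/QuantumLattice`; companion of `HubbardEffectiveActionCTSymmetry.lean` (the point group
`D₄`, same template) and `HubbardEffectiveActionCT.lean` (`hubbardEffectiveActionCT L M β U μ h K Λ = effAction ℂ C^K_{>Λ} V_K`).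
Benfatto–Giuliani–Mastropietro 2006 §2.1 list among the symmetries of the Gaussian integration `P(dψ)` and of
the interaction `V`: "(1) spin exchange: `ψ^ε_{x,↑} ↔ ψ^ε_{x,↓}`".  Here the exchange is the permutation of the field
labels `((k, σ), c) ↦ ((k, σ̄), c)` (`σ̄ = Equiv.swap 0 1 σ`), written WITHOUT a new definition (and without notation) as
`𝔰 = Equiv.prodCongr (Equiv.prodCongr (Equiv.refl _) (Equiv.swap 0 1)) (Equiv.refl _)` at every use; the induced algebra map is
`ExteriorAlgebra.map (LinearMap.funLeft ℂ ℂ 𝔰.symm)`.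

## Main statements (all proved; no definitions)

* `nambuPropagatorCT_zero_seed_apply01/10`, `nambuPropagatorCT_zero_seed_neg_one_one` — at `h = 0`
  the CT Nambu propagator is diagonal and `G_K(−k)₂₂ = −G_K(k)₁₁` (`e_K` even, `ω_{rev i} = −ω_i`);
* **`hubbardTwoPointCT_spinFlip`**, `hubbardCovarianceCT_spinFlip`, **`hubbardCovAboveCT_spinFlip`** — at seed `h = 0`
  the CT two-point table / covariance / covariance above scale `Λ` are invariant under the simultaneous spin
  exchange of both labels (the `↓↓` entries, carried by the Nambu index `2` at `−k` with reversed charges, equal the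
  `↑↑` ones; the `↑↓` entries vanish without seed);
* `map_spinFlip_hubbardInteraction`, `map_spinFlip_counterQuadratic`, **`map_spinFlip_hubbardInteractionCT`** — the
  Hubbard vertex `Σ ψ̂⁺_{k₁↑}ψ̂⁻_{k₂↑}ψ̂⁺_{k₃↓}ψ̂⁻_{k₄↓}` (exchange `(k₁,k₂) ↔ (k₃,k₄)`; even pairs commute) and the
  counterterm `𝒩_K` are invariant;
* **`map_spinFlip_hubbardEffectiveActionCT`**, **`kernel_hubbardEffectiveActionCT_spinFlip`** — `𝒢^K_Λ ∘ 𝔰⁻¹ = 𝒢^K_Λ` at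
  `h = 0` and every kernel is invariant under the exchange of all its arguments;
* `selfEnergy_spinFlip`, **`selfEnergy_hubbardEffectiveActionCT_spinFlip`**,
  **`selfEnergy_hubbardEffectiveActionCT_spin_eq`** — the self-energy of `𝒢^K_Λ` is spin independent:
  `Σ((ω,k⃗), σ) = Σ((ω,k⃗), ↑)`.

## Sources

G. Benfatto, A. Giuliani, V. Mastropietro, Ann. Henri Poincaré 7 (2006) 809, §2.1, symmetry (1) (spin exchange)
[`BenfattoGiulianiMastropietro2006`]; the Berezin-level permutation rule is `GrassmannGaussianSymmetry.lean`
(`berezin_grassmannExp_quadratic_mul_map_perm`); the `effAction`-level equivariance is `GrassmannRelabelling.lean`.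
Routine ("folklore") consequences.
-/

noncomputable section

namespace Literature.MathematicalPhysics.QuantumLattice

open Literature.Probability.LatticeModels GrassmannAlgebra Finset

/-! ### One-body facts at zero seed -/

section OneBody

variable (L M : ℕ)

/-- At `h = 0` the CT Nambu propagator has no anomalous entry `G₁₂`. [cite: BenfattoGiulianiMastropietro2006, §2.1 symmetry (1)] -/
@[simp] theorem nambuPropagatorCT_zero_seed_apply01 (β μ : ℝ) (K : TrigPolyC4v) (k : FreqMomentum L M) :
    nambuPropagatorCT L M β μ 0 K k 0 1 = 0 := by
  simp [nambuPropagatorCT]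

/-- At `h = 0` the CT Nambu propagator has no anomalous entry `G₂₁`. [cite: BenfattoGiulianiMastropietro2006, §2.1 symmetry (1)] -/
@[simp] theorem nambuPropagatorCT_zero_seed_apply10 (β μ : ℝ) (K : TrigPolyC4v) (k : FreqMomentum L M) :
    nambuPropagatorCT L M β μ 0 K k 1 0 = 0 := by
  simp [nambuPropagatorCT]

/-- `k ↦ -k` is injective on frequency–momenta. [cite: BenfattoGiulianiMastropietro2006, §2.1 symmetry (1)] -/
private theorem FreqMomentum.neg_inj' {L M : ℕ} {k k' : FreqMomentum L M} : k.neg = k'.neg ↔ k = k' :=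
  ⟨fun h => by simpa using congrArg FreqMomentum.neg h, fun h => h ▸ rfl⟩

variable [NeZero L]

/-- The CT denominator is even: `den(−k) = den(k)` (`ω_{−k} = −ω_k`, `e_K`, `φ_d` even). [cite: BenfattoGiulianiMastropietro2006, §2.1 symmetry (1)] -/
private theorem nambuDenCT_neg' (β μ h : ℝ) (K : TrigPolyC4v) (k : FreqMomentum L M) :
    nambuDenCT L M β μ h K k.neg = nambuDenCT L M β μ h K k := by
  simp only [nambuDenCT, FreqMomentum.neg, matsubaraFreq_rev, nambuXiCT_neg, dWaveSymbol_neg, neg_sq]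

/-- **`G_K(−k)₂₂ = −G_K(k)₁₁` at zero seed**: `(i(−ω) − e_K(−k⃗))/den = −(iω + e_K(k⃗))/den`. [cite: BenfattoGiulianiMastropietro2006, §2.1 symmetry (1)] -/
theorem nambuPropagatorCT_zero_seed_neg_one_one (β μ : ℝ) (K : TrigPolyC4v) (k : FreqMomentum L M) :
    nambuPropagatorCT L M β μ 0 K k.neg 1 1 = -nambuPropagatorCT L M β μ 0 K k 0 0 := by
  rw [nambuPropagatorCT, nambuPropagatorCT, nambuDenCT_neg']
  simp only [Matrix.of_apply, Matrix.cons_val', Matrix.cons_val_zero, Matrix.cons_val_one, Matrix.cons_val_fin_one,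
    FreqMomentum.neg, matsubaraFreq_rev, nambuXiCT_neg]
  push_cast
  ring

end OneBody

/-! ### Spin exchange on the field labels; invariance of the CT covariance at `h = 0` -/

section Fields

variable (L M : ℕ)

/-- The spin exchange in coordinates. [cite: BenfattoGiulianiMastropietro2006, §2.1 symmetry (1)] -/
theorem spinFlipField_apply (X : HubbardFieldIdx L M) :
    (Equiv.prodCongr (Equiv.prodCongr (Equiv.refl (FreqMomentum L M)) (Equiv.swap (0 : Fin 2) 1)) (Equiv.refl (Fin 2))) X = ((X.1.1, Equiv.swap (0 : Fin 2) 1 X.1.2), X.2) := rfl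

/-- The relabelling on `ψ̂⁺`: `ψ̂⁺_{k,σ} ↦ ψ̂⁺_{k,σ̄}`. [cite: BenfattoGiulianiMastropietro2006, §2.1 symmetry (1)] -/
theorem map_spinFlip_psiPlus (k : FreqMomentum L M) (s : Fin 2) :
    (ExteriorAlgebra.map (LinearMap.funLeft ℂ ℂ (Equiv.symm (Equiv.prodCongr (Equiv.prodCongr (Equiv.refl (FreqMomentum L M)) (Equiv.swap (0 : Fin 2) 1)) (Equiv.refl (Fin 2)))))) (psiPlus k s) = psiPlus k (Equiv.swap (0 : Fin 2) 1 s) := by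
  unfold psiPlus
  rw [map_funLeft_gen]
  rfl

/-- The relabelling on `ψ̂⁻`: `ψ̂⁻_{k,σ} ↦ ψ̂⁻_{k,σ̄}`. [cite: BenfattoGiulianiMastropietro2006, §2.1 symmetry (1)] -/
theorem map_spinFlip_psiMinus (k : FreqMomentum L M) (s : Fin 2) :
    (ExteriorAlgebra.map (LinearMap.funLeft ℂ ℂ (Equiv.symm (Equiv.prodCongr (Equiv.prodCongr (Equiv.refl (FreqMomentum L M)) (Equiv.swap (0 : Fin 2) 1)) (Equiv.refl (Fin 2)))))) (psiMinus k s) = psiMinus k (Equiv.swap (0 : Fin 2) 1 s) := by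
  unfold psiMinus
  rw [map_funLeft_gen]
  rfl

/-- `rev 1 = 0` in `Fin 2` (the charge flip of the Nambu relabelling). [cite: BenfattoGiulianiMastropietro2006, §2.1 symmetry (1)] -/
private theorem fin_two_rev_one : Fin.rev (1 : Fin 2) = 0 := by decide

variable [NeZero L]

/-- **The seedless CT two-point table is invariant under spin exchange of both labels**:
`⟨ψ_{𝔰X} ψ_{𝔰Y}⟩₀^K = ⟨ψ_X ψ_Y⟩₀^K` at `h = 0` — the `↓↓` table, read through the Nambu index `2` at `−k` with reversed
charges, equals the `↑↑` one by `G_K(−k)₂₂ = −G_K(k)₁₁`, and the mixed-spin entries vanish without seed. [cite: BenfattoGiulianiMastropietro2006, §2.1 symmetry (1)] -/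
theorem hubbardTwoPointCT_spinFlip (β μ : ℝ) (K : TrigPolyC4v) (X Y : HubbardFieldIdx L M) :
    hubbardTwoPointCT L M β μ 0 K ((Equiv.prodCongr (Equiv.prodCongr (Equiv.refl (FreqMomentum L M)) (Equiv.swap (0 : Fin 2) 1)) (Equiv.refl (Fin 2))) X) ((Equiv.prodCongr (Equiv.prodCongr (Equiv.refl (FreqMomentum L M)) (Equiv.swap (0 : Fin 2) 1)) (Equiv.refl (Fin 2))) Y) = hubbardTwoPointCT L M β μ 0 K X Y := by
  obtain ⟨⟨k, s⟩, c⟩ := X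
  obtain ⟨⟨k', s'⟩, c'⟩ := Y
  by_cases hk : k = k'
  · subst hk
    fin_cases s <;> fin_cases s' <;> fin_cases c <;> fin_cases c' <;>
      simp [hubbardTwoPointCT, toNambu, nambuTwoPointCT, Equiv.swap_apply_left, Equiv.swap_apply_right,
        fin_two_rev_one, nambuPropagatorCT_zero_seed_neg_one_one]
  · have hk' : ¬ k' = k := fun h => hk h.symm
    have hkn : ¬ k.neg = k'.neg := fun h => hk (FreqMomentum.neg_inj'.1 h)
    have hkn' : ¬ k'.neg = k.neg := fun h => hk' (FreqMomentum.neg_inj'.1 h)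
    fin_cases s <;> fin_cases s' <;> fin_cases c <;> fin_cases c' <;>
      simp [hubbardTwoPointCT, toNambu, nambuTwoPointCT, Equiv.swap_apply_left, Equiv.swap_apply_right,
        fin_two_rev_one, hk, hk', hkn, hkn']

/-- **The seedless CT covariance is invariant under spin exchange**: `C^K(𝔰X, 𝔰Y) = C^K(X, Y)` at `h = 0`. [cite: BenfattoGiulianiMastropietro2006, §2.1 symmetry (1)] -/
theorem hubbardCovarianceCT_spinFlip (β μ : ℝ) (K : TrigPolyC4v) (X Y : HubbardFieldIdx L M) :
    hubbardCovarianceCT L M β μ 0 K ((Equiv.prodCongr (Equiv.prodCongr (Equiv.refl (FreqMomentum L M)) (Equiv.swap (0 : Fin 2) 1)) (Equiv.refl (Fin 2))) X) ((Equiv.prodCongr (Equiv.prodCongr (Equiv.refl (FreqMomentum L M)) (Equiv.swap (0 : Fin 2) 1)) (Equiv.refl (Fin 2))) Y) = hubbardCovarianceCT L M β μ 0 K X Y := by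
  simp only [hubbardCovarianceCT, Matrix.of_apply, hubbardTwoPointCT_spinFlip]

/-- **The seedless CT covariance above scale `Λ` is invariant under spin exchange**:
`C^K_{>Λ}(𝔰X, 𝔰Y) = C^K_{>Λ}(X, Y)` (the cutoff weight reads the frequency–momentum only) — the symmetry (1) of the
Gaussian integration, BGM 2006 §2.1, for the countertermed measure. [cite: BenfattoGiulianiMastropietro2006, §2.1 symmetry (1)] -/
theorem hubbardCovAboveCT_spinFlip (β μ : ℝ) (K : TrigPolyC4v) (Λ : ℝ) (X Y : HubbardFieldIdx L M) :
    hubbardCovAboveCT L M β μ 0 K Λ ((Equiv.prodCongr (Equiv.prodCongr (Equiv.refl (FreqMomentum L M)) (Equiv.swap (0 : Fin 2) 1)) (Equiv.refl (Fin 2))) X) ((Equiv.prodCongr (Equiv.prodCongr (Equiv.refl (FreqMomentum L M)) (Equiv.swap (0 : Fin 2) 1)) (Equiv.refl (Fin 2))) Y) = hubbardCovAboveCT L M β μ 0 K Λ X Y := by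
  simp only [hubbardCovAboveCT, Matrix.of_apply, hubbardCovarianceCT_spinFlip]
  rfl

/-! ### Invariance of the interaction slot and of the effective action -/

omit [NeZero L] in
/-- Two even pairs of generators commute: `(ψ_a ψ_b)(ψ_c ψ_d) = (ψ_c ψ_d)(ψ_a ψ_b)`. [cite: BenfattoGiulianiMastropietro2006, §2.1 symmetry (1)] -/
theorem gen_pair_mul_gen_pair_comm (a b c d : HubbardFieldIdx L M) :
    gen ℂ a * gen ℂ b * (gen ℂ c * gen ℂ d) = gen ℂ c * gen ℂ d * (gen ℂ a * gen ℂ b) := by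
  have hcomm : ∀ x y z : HubbardFieldIdx L M, gen ℂ z * (gen ℂ x * gen ℂ y) = gen ℂ x * gen ℂ y * gen ℂ z := by
    intro x y z
    calc gen ℂ z * (gen ℂ x * gen ℂ y) = (gen ℂ z * gen ℂ x) * gen ℂ y := (mul_assoc _ _ _).symm
      _ = -(gen ℂ x * gen ℂ z) * gen ℂ y := by rw [gen_mul_gen (R := ℂ) z x]
      _ = -(gen ℂ x * (gen ℂ z * gen ℂ y)) := by rw [neg_mul, mul_assoc]
      _ = -(gen ℂ x * -(gen ℂ y * gen ℂ z)) := by rw [gen_mul_gen (R := ℂ) z y]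
      _ = gen ℂ x * gen ℂ y * gen ℂ z := by rw [mul_neg, neg_neg, mul_assoc]
  calc gen ℂ a * gen ℂ b * (gen ℂ c * gen ℂ d)
      = gen ℂ a * (gen ℂ b * (gen ℂ c * gen ℂ d)) := mul_assoc _ _ _
    _ = gen ℂ a * (gen ℂ c * gen ℂ d * gen ℂ b) := by rw [hcomm c d b]
    _ = (gen ℂ a * (gen ℂ c * gen ℂ d)) * gen ℂ b := by rw [← mul_assoc]
    _ = (gen ℂ c * gen ℂ d * gen ℂ a) * gen ℂ b := by rw [hcomm c d a]
    _ = gen ℂ c * gen ℂ d * (gen ℂ a * gen ℂ b) := mul_assoc _ _ _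

omit [NeZero L] in
/-- Two `ψ̂⁺ψ̂⁻` pairs commute: `(ψ̂⁺_{a,t}ψ̂⁻_{b,t})(ψ̂⁺_{c,s}ψ̂⁻_{d,s}) = (ψ̂⁺_{c,s}ψ̂⁻_{d,s})(ψ̂⁺_{a,t}ψ̂⁻_{b,t})` (even elements).
[cite: BenfattoGiulianiMastropietro2006, §2.1 symmetry (1)] -/
theorem psi_pairs_comm (a b c d : FreqMomentum L M) (t s : Fin 2) :
    psiPlus a t * psiMinus b t * psiPlus c s * psiMinus d s = psiPlus c s * psiMinus d s * psiPlus a t * psiMinus b t :=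
  calc psiPlus a t * psiMinus b t * psiPlus c s * psiMinus d s
      = (psiPlus a t * psiMinus b t) * (psiPlus c s * psiMinus d s) := mul_assoc _ _ _
    _ = (psiPlus c s * psiMinus d s) * (psiPlus a t * psiMinus b t) :=
        gen_pair_mul_gen_pair_comm L M ((a, t), 0) ((b, t), 1) ((c, s), 0) ((d, s), 1)
    _ = psiPlus c s * psiMinus d s * psiPlus a t * psiMinus b t := (mul_assoc _ _ _).symm

omit [NeZero L] in
/-- Reordering a fourfold sum: `Σ_a Σ_b Σ_c Σ_d H c d a b = Σ_c Σ_d Σ_a Σ_b H c d a b`. [cite: BenfattoGiulianiMastropietro2006, §2.1 symmetry (1)] -/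
theorem sum_four_reorder {α : Type*} [Fintype α] {N : Type*} [AddCommMonoid N] (H : α → α → α → α → N) :
    ∑ a, ∑ b, ∑ c, ∑ d, H c d a b = ∑ c, ∑ d, ∑ a, ∑ b, H c d a b := by
  calc ∑ a, ∑ b, ∑ c, ∑ d, H c d a b = ∑ a, ∑ c, ∑ b, ∑ d, H c d a b :=
        Finset.sum_congr rfl fun a _ => Finset.sum_comm
    _ = ∑ c, ∑ a, ∑ b, ∑ d, H c d a b := Finset.sum_comm
    _ = ∑ c, ∑ a, ∑ d, ∑ b, H c d a b :=
        Finset.sum_congr rfl fun c _ => Finset.sum_congr rfl fun a _ => Finset.sum_comm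
    _ = ∑ c, ∑ d, ∑ a, ∑ b, H c d a b := Finset.sum_congr rfl fun c _ => Finset.sum_comm

/-- **The Hubbard vertex is invariant under spin exchange**: `V ∘ 𝔰⁻¹ = V` — exchanging `↑ ↔ ↓` maps the summand
`ψ̂⁺_{k₁↑}ψ̂⁻_{k₂↑}ψ̂⁺_{k₃↓}ψ̂⁻_{k₄↓}` to the one with `(k₁,k₂) ↔ (k₃,k₄)` (the two even pairs commute and momentum
conservation `k₁ + k₃ = k₂ + k₄` is symmetric); BGM 2006 §2.1 symmetry (1). [cite: BenfattoGiulianiMastropietro2006, §2.1 symmetry (1)] -/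
theorem map_spinFlip_hubbardInteraction (β U : ℝ) :
    (ExteriorAlgebra.map (LinearMap.funLeft ℂ ℂ (Equiv.symm (Equiv.prodCongr (Equiv.prodCongr (Equiv.refl (FreqMomentum L M)) (Equiv.swap (0 : Fin 2) 1)) (Equiv.refl (Fin 2)))))) (hubbardInteraction L M β U) = hubbardInteraction L M β U := by
  rw [hubbardInteraction, map_smul]
  congr 1
  simp only [map_sum]
  rw [sum_four_reorder (H := fun k₃ k₄ k₁ k₂ =>
    (ExteriorAlgebra.map (LinearMap.funLeft ℂ ℂ (Equiv.symm (Equiv.prodCongr (Equiv.prodCongr (Equiv.refl (FreqMomentum L M)) (Equiv.swap (0 : Fin 2) 1)) (Equiv.refl (Fin 2)))))) (if matsubaraInt M k₁.1 + matsubaraInt M k₃.1 = matsubaraInt M k₂.1 + matsubaraInt M k₄.1 ∧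
        k₁.2 + k₃.2 = k₂.2 + k₄.2 then psiPlus k₁ 0 * psiMinus k₂ 0 * psiPlus k₃ 1 * psiMinus k₄ 1 else 0))]
  refine Finset.sum_congr rfl fun k₁ _ => Finset.sum_congr rfl fun k₂ _ => Finset.sum_congr rfl fun k₃ _ =>
    Finset.sum_congr rfl fun k₄ _ => ?_
  have hcond : (matsubaraInt M k₃.1 + matsubaraInt M k₁.1 = matsubaraInt M k₄.1 + matsubaraInt M k₂.1 ∧
      k₃.2 + k₁.2 = k₄.2 + k₂.2) ↔
      (matsubaraInt M k₁.1 + matsubaraInt M k₃.1 = matsubaraInt M k₂.1 + matsubaraInt M k₄.1 ∧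
        k₁.2 + k₃.2 = k₂.2 + k₄.2) := by
    rw [add_comm (matsubaraInt M k₃.1), add_comm (matsubaraInt M k₄.1), add_comm k₃.2, add_comm k₄.2]
  split_ifs with h₁ h₂ h₂
  · simp only [map_mul, map_spinFlip_psiPlus, map_spinFlip_psiMinus, Equiv.swap_apply_left, Equiv.swap_apply_right]
    exact psi_pairs_comm L M k₃ k₄ k₁ k₂ 1 0
  · exact absurd (hcond.1 h₁) h₂
  · exact absurd (hcond.2 h₂) h₁
  · exact map_zero _

/-- **The counterterm vertex is invariant under spin exchange**: `𝒩_K ∘ 𝔰⁻¹ = 𝒩_K` (it is summed over the spin). [cite: BenfattoGiulianiMastropietro2006, §2.1 symmetry (1)] -/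
theorem map_spinFlip_counterQuadratic (β : ℝ) (K : TrigPolyC4v) :
    (ExteriorAlgebra.map (LinearMap.funLeft ℂ ℂ (Equiv.symm (Equiv.prodCongr (Equiv.prodCongr (Equiv.refl (FreqMomentum L M)) (Equiv.swap (0 : Fin 2) 1)) (Equiv.refl (Fin 2)))))) (counterQuadratic L M β K) = counterQuadratic L M β K := by
  rw [counterQuadratic, map_sum]
  refine Finset.sum_congr rfl fun k _ => ?_
  rw [map_sum]
  refine Fintype.sum_equiv (Equiv.swap (0 : Fin 2) 1) _ _ fun s => ?_
  simp only [map_smul, map_mul, map_spinFlip_psiPlus, map_spinFlip_psiMinus]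

/-- **The interaction slot `V_K = V + 𝒩_K` is invariant under spin exchange.** [cite: BenfattoGiulianiMastropietro2006, §2.1 symmetry (1)] -/
theorem map_spinFlip_hubbardInteractionCT (β U : ℝ) (K : TrigPolyC4v) :
    (ExteriorAlgebra.map (LinearMap.funLeft ℂ ℂ (Equiv.symm (Equiv.prodCongr (Equiv.prodCongr (Equiv.refl (FreqMomentum L M)) (Equiv.swap (0 : Fin 2) 1)) (Equiv.refl (Fin 2)))))) (hubbardInteractionCT L M β U K) = hubbardInteractionCT L M β U K := by
  rw [hubbardInteractionCT, map_add, map_spinFlip_hubbardInteraction, map_spinFlip_counterQuadratic]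

/-- **Spin exchange is a symmetry of the seedless countertermed effective action**: `𝒢^K_Λ ∘ 𝔰⁻¹ = 𝒢^K_Λ` at `h = 0`,
for every frame `K` and scale `Λ` (covariance and interaction are invariant, `effAction` is equivariant). [cite: BenfattoGiulianiMastropietro2006, §2.1 symmetry (1)] -/
theorem map_spinFlip_hubbardEffectiveActionCT (β U μ : ℝ) (K : TrigPolyC4v) (Λ : ℝ) :
    (ExteriorAlgebra.map (LinearMap.funLeft ℂ ℂ (Equiv.symm (Equiv.prodCongr (Equiv.prodCongr (Equiv.refl (FreqMomentum L M)) (Equiv.swap (0 : Fin 2) 1)) (Equiv.refl (Fin 2)))))) (hubbardEffectiveActionCT L M β U μ 0 K Λ) = hubbardEffectiveActionCT L M β U μ 0 K Λ :=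
  map_funLeft_effAction_of_invariant ℂ _ (hubbardCovAboveCT_spinFlip L M β μ K Λ)
    (map_spinFlip_hubbardInteractionCT L M β U K)

/-- The seedless CT partition function of the spin-exchanged interaction is unchanged. [cite: BenfattoGiulianiMastropietro2006, §2.1 symmetry (1)] -/
theorem hubbardEffPartitionFnCT_spinFlip (β U μ : ℝ) (K : TrigPolyC4v) (Λ : ℝ) :
    effPartitionFn ℂ (hubbardCovAboveCT L M β μ 0 K Λ) ((ExteriorAlgebra.map (LinearMap.funLeft ℂ ℂ (Equiv.symm (Equiv.prodCongr (Equiv.prodCongr (Equiv.refl (FreqMomentum L M)) (Equiv.swap (0 : Fin 2) 1)) (Equiv.refl (Fin 2)))))) (hubbardInteractionCT L M β U K)) =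
      hubbardEffPartitionFnCT L M β U μ 0 K Λ :=
  effPartitionFn_of_invariant ℂ _ (hubbardCovAboveCT_spinFlip L M β μ K Λ) _

/-- **The kernels of the seedless countertermed effective action are invariant under spin exchange of all their
arguments**: `F_m(𝔰X_0, …, 𝔰X_{m-1}) = F_m(X_0, …, X_{m-1})`. [cite: BenfattoGiulianiMastropietro2006, §2.1 symmetry (1)] -/
theorem kernel_hubbardEffectiveActionCT_spinFlip (β U μ : ℝ) (K : TrigPolyC4v) (Λ : ℝ) (m : ℕ)
    (X : Fin m → HubbardFieldIdx L M) :
    kernel ℂ (hubbardEffectiveActionCT L M β U μ 0 K Λ) m ((Equiv.prodCongr (Equiv.prodCongr (Equiv.refl (FreqMomentum L M)) (Equiv.swap (0 : Fin 2) 1)) (Equiv.refl (Fin 2))) ∘ X) =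
      kernel ℂ (hubbardEffectiveActionCT L M β U μ 0 K Λ) m X :=
  kernel_comp_perm_of_invariant ℂ _ (map_spinFlip_hubbardEffectiveActionCT L M β U μ K Λ) m X

end Fields

/-! ### The self-energy is spin independent -/

section Functionals

variable (L M : ℕ) {G : HubbardGrassmann L M}
  (hG : ∀ (m : ℕ) (X : Fin m → HubbardFieldIdx L M),
    kernel ℂ G m ((Equiv.prodCongr (Equiv.prodCongr (Equiv.refl (FreqMomentum L M)) (Equiv.swap (0 : Fin 2) 1))
      (Equiv.refl (Fin 2))) ∘ X) = kernel ℂ G m X)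

include hG

/-- **The self-energy of a spin-exchange-invariant `G` is invariant**: `Σ(k, σ̄) = Σ(k, σ)`. [cite: BenfattoGiulianiMastropietro2006, §2.1 symmetry (1)] -/
theorem selfEnergy_spinFlip (β : ℝ) (k : FreqMomentum L M) (s : Fin 2) :
    selfEnergy L M β G k (Equiv.swap (0 : Fin 2) 1 s) = selfEnergy L M β G k s := by
  rw [selfEnergy, selfEnergy, vertexFn, vertexFn, ← hG 2 ![((k, s), 0), ((k, s), 1)]]
  congr 2
  funext i
  fin_cases i <;> rfl

/-- The self-energy of a spin-exchange-invariant `G` is spin independent: `Σ(k, σ) = Σ(k, ↑)`. [cite: BenfattoGiulianiMastropietro2006, §2.1 symmetry (1)] -/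
theorem selfEnergy_spin_eq_zero (β : ℝ) (k : FreqMomentum L M) (s : Fin 2) :
    selfEnergy L M β G k s = selfEnergy L M β G k 0 := by
  fin_cases s
  · rfl
  · have h := selfEnergy_spinFlip L M hG β k 0
    rw [Equiv.swap_apply_left] at h
    exact h

end Functionals

section CT

variable (L M : ℕ) [NeZero L]

/-- **The self-energy of `𝒢^K_Λ` (seed `h = 0`) is invariant under spin exchange**: `Σ((ω,k⃗), σ̄) = Σ((ω,k⃗), σ)`. [cite: BenfattoGiulianiMastropietro2006, §2.1 symmetry (1)] -/
theorem selfEnergy_hubbardEffectiveActionCT_spinFlip (β U μ : ℝ) (K : TrigPolyC4v) (Λ : ℝ) (k : FreqMomentum L M)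
    (s : Fin 2) :
    selfEnergy L M β (hubbardEffectiveActionCT L M β U μ 0 K Λ) k (Equiv.swap (0 : Fin 2) 1 s) =
      selfEnergy L M β (hubbardEffectiveActionCT L M β U μ 0 K Λ) k s :=
  selfEnergy_spinFlip L M (kernel_hubbardEffectiveActionCT_spinFlip L M β U μ K Λ) β k s

/-- **The self-energy of `𝒢^K_Λ` (seed `h = 0`) is spin independent**: `Σ((ω,k⃗), σ) = Σ((ω,k⃗), ↑)` — BGM 2006 §2.1
symmetry (1) for the countertermed effective action at every scale. [cite: BenfattoGiulianiMastropietro2006, §2.1 symmetry (1)] -/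
theorem selfEnergy_hubbardEffectiveActionCT_spin_eq (β U μ : ℝ) (K : TrigPolyC4v) (Λ : ℝ) (k : FreqMomentum L M)
    (s : Fin 2) :
    selfEnergy L M β (hubbardEffectiveActionCT L M β U μ 0 K Λ) k s =
      selfEnergy L M β (hubbardEffectiveActionCT L M β U μ 0 K Λ) k 0 :=
  selfEnergy_spin_eq_zero L M (kernel_hubbardEffectiveActionCT_spinFlip L M β U μ K Λ) β k s

end CT

end Literature.MathematicalPhysics.QuantumLattice
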